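import Mathlib
import HarnessLib
import Summits.HubbardSuperconductivity.HubbardSuperconductivity.Theorems.KLProgrammeKLRegimeSplitEdgeFactsBandJetsSup
import Summits.HubbardSuperconductivity.HubbardSuperconductivity.Theorems.KLProgrammeKLRegimeSplitEdgeFactsLevelSetFloorColumns
import Summits.HubbardSuperconductivity.HubbardSuperconductivity.Theorems.KLProgrammeKLRegimeSplitEdgeFactsBandJets

/-!
# Route `KLProgramme` — edge facts for the pair masses ACROSS TRANSFERS, XV′: the LEVEL-SET FLOOR from crossing columns (row 29 `…LevelSetFloorColumns`)
# with an ABSTRACT first-jet constant `v` — `kllfv_abs_nambuXiCT_step_le` (`|e_K(a,b+1) − e_K(a,b)| ≤ v·2π/L`), `kllfv_column_window_card_ge`, `kllfv_levelSet_card_ge`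

Cell gate-hubbard-kl, seat hubbard-kl-k3c1-p1 (g22; child-1 lineage); cure of the located «(s2)-JETS-COEFFNORM-KEYING».  Row 29 re-proved ONCE over the abstract
forward jet (section hypotheses `hjet`, `hjv : 4 ≤ v`; `hjκ` is never used here and omitted throughout): the vertical step of a column is `≤ v·2π/L`, so
`#{A ≤ e_K ≤ B} ≥ #C·((B − A)L/(2πv) − 1)` for any set `C` of crossing columns.  Instantiable by row 20 (`v = 4 + coeffNorm 1 K`) and by row 20′ `…BandJetsSup`
(`v = 4 + 2A_K`, regime-native — for the flow frames `coeffNorm 1 K_n ≈ 2¹⁴·n·cr|U|` is not n-flat while `A_K` is).  Statements and proofs are row 29's verbatim with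
the substitution; the jet-free lemmas (`kllf_window_count_ge`, `kllf_colPt_succ`) are imported, not restated.  Everything is proved; no definitions; nothing asserts any
slot, stub, K3 or SC. [folklore]
-/

noncomputable section

namespace Summit.HubbardSuperconductivity.HubbardSuperconductivity.Theorems.KLRegimeSplit

set_option linter.dupNamespace false -- summit = problem name (single-conjunct summit), D-0017

open Real Finset Literature.MathematicalPhysics.QuantumLattice Literature.Probability.LatticeModels
open Summit.HubbardSuperconductivity.HubbardSuperconductivity.Theorems.KLProgrammeLegKernels

/-! ## §1 The discrete crossing count -/

/-! ## §2 Columns of the momentum grid -/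

section Grid

variable {L : ℕ} [NeZero L] (μ : ℝ) (K : TrigPolyC4v)
variable {v κ : ℝ}
  (hjet : (∀ k Q : TorusSite 2 L, |nambuXiCT L μ K (k + Q) - nambuXiCT L μ K k| ≤ v * klTorusNorm L Q) ∧
    (∀ k Q : TorusSite 2 L, |nambuXiCT L μ K (k - Q) - nambuXiCT L μ K k| ≤ v * klTorusNorm L Q) ∧
      ∀ k Q : TorusSite 2 L, |nambuXiCT L μ K (k + Q) - 2 * nambuXiCT L μ K k + nambuXiCT L μ K (k - Q)| ≤ κ * klTorusNorm L Q ^ 2)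
  (hjv : 4 ≤ v) (hjκ : 4 ≤ κ)
include hjet hjv hjκ

omit hjκ in
/-- **The vertical step of the band**: `|e_K(a, b+1) − e_K(a, b)| ≤ v·2π/L` (row 20 at the step `Q = e₂`, `|p_{e₂}|_𝕋 ≤ 2π/L`). [folklore] -/
theorem kllfv_abs_nambuXiCT_step_le (k : TorusSite 2 L) :
    |nambuXiCT L μ K (k + Pi.single 1 1) - nambuXiCT L μ K k| ≤ v * (2 * π / L) := by
  have h := hjet.1 k (Pi.single 1 1)
  have hv : 0 ≤ v := by linarith
  refine h.trans (mul_le_mul_of_nonneg_left ?_ hv)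
  -- `|p_{e₂}|_𝕋 = max(|0|_𝕋, |2π·val 1/L|_𝕋) ≤ 2π/L`
  have hL : (0 : ℝ) < L := by exact_mod_cast Nat.pos_of_ne_zero (NeZero.ne L)
  have h1 : ((1 : ZMod L).val : ℝ) ≤ 1 := by
    have := ZMod.val_one_eq_one_mod L
    have h2 : (1 : ZMod L).val ≤ 1 := by rw [this]; exact Nat.mod_le 1 L
    exact_mod_cast h2
  unfold klTorusNorm KLProgrammeLegKernels.torusSupNorm
  refine max_le ?_ ?_
  · simp only [latticeMomentum, Pi.single_eq_of_ne (show (0 : Fin 2) ≠ 1 by decide), ZMod.val_zero, Nat.cast_zero, mul_zero, zero_div]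
    rw [klvc_torusAbs_zero]; positivity
  · simp only [latticeMomentum, Pi.single_eq_same]
    refine (klvc_torusAbs_le_abs _).trans ?_
    rw [abs_of_nonneg (by positivity)]
    calc 2 * π * ((1 : ZMod L).val : ℝ) / L ≤ 2 * π * 1 / L := by gcongr
      _ = 2 * π / L := by ring

omit hjκ in
/-- **Window count along one crossing column**: if the column `k⃗₀ = a` contains a point with `e_K < A` and a point with `B < e_K` (`A ≤ B`), then
`(B − A)·L/(2πv) − 1 ≤ #{k⃗ : k⃗₀ = a ∧ A ≤ e_K(p_k⃗) ≤ B}`. [folklore] -/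
theorem kllfv_column_window_card_ge {A B : ℝ} (hAB : A ≤ B) (a : ZMod L) {klo khi : TorusSite 2 L} (hklo : klo 0 = a) (hkhi : khi 0 = a)
    (hlo : nambuXiCT L μ K klo < A) (hhi : B < nambuXiCT L μ K khi) :
    (B - A) * L / (2 * π * v) - 1 ≤
      (((univ : Finset (TorusSite 2 L)).filter fun k => k 0 = a ∧ (A ≤ nambuXiCT L μ K k ∧ nambuXiCT L μ K k ≤ B)).card : ℝ) := by
  classical
  have hL : (0 : ℝ) < L := by exact_mod_cast Nat.pos_of_ne_zero (NeZero.ne L)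
  have hv : 0 < v := by linarith
  set δ := v * (2 * π / L) with hδ
  have hδ0 : 0 < δ := by positivity
  -- the column path from `klo`
  set b := klo 1 with hb
  set f : ℕ → ℝ := fun t => nambuXiCT L μ K ![a, b + (t : ZMod L)] with hf
  have hkloeq : klo = ![a, b + ((0 : ℕ) : ZMod L)] := by
    ext i; fin_cases i
    · simp [hklo]
    · simp [hb]
  set T := (khi 1 - b).val with hT
  have hTlt : T < L := ZMod.val_lt _
  have hkhieq : khi = ![a, b + ((T : ℕ) : ZMod L)] := by
    ext i; fin_cases i
    · simp [hkhi]
    · simp [hT]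
  have h0 : f 0 < A := by simp only [hf]; rw [← hkloeq]; exact hlo
  have hTB : B < f T := by simp only [hf]; rw [← hkhieq]; exact hhi
  have hstep : ∀ i < T, |f (i + 1) - f i| ≤ δ := fun i _ => by
    simp only [hf]
    rw [kllf_colPt_succ]
    exact kllfv_abs_nambuXiCT_step_le μ K hjet hjv _
  have hcount := kllf_window_count_ge f hAB hδ0 T h0 hTB hstep
  -- the window times inject into the column window set
  set W := (univ : Finset (TorusSite 2 L)).filter fun k => k 0 = a ∧ (A ≤ nambuXiCT L μ K k ∧ nambuXiCT L μ K k ≤ B) with hW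
  set ι : ℕ → TorusSite 2 L := fun t => ![a, b + (t : ZMod L)] with hι
  have hinj : Set.InjOn ι ((range T).filter fun i => A ≤ f i ∧ f i ≤ B : Finset ℕ) := by
    intro t ht t' ht' h
    have htT : t < T := mem_range.1 (mem_filter.1 ht).1
    have ht'T : t' < T := mem_range.1 (mem_filter.1 ht').1
    have h1 : (b + (t : ZMod L)) = b + (t' : ZMod L) := by
      have := congrFun h 1
      simpa [hι] using this
    have h2 : ((t : ZMod L)) = (t' : ZMod L) := add_left_cancel h1
    have h3 := (ZMod.natCast_eq_natCast_iff' t t' L).1 h2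
    rw [Nat.mod_eq_of_lt (by omega), Nat.mod_eq_of_lt (by omega)] at h3
    exact h3
  have himg : ((range T).filter fun i => A ≤ f i ∧ f i ≤ B).image ι ⊆ W := by
    intro k hk
    obtain ⟨t, ht, rfl⟩ := mem_image.1 hk
    obtain ⟨-, h1, h2⟩ := mem_filter.1 ht
    rw [hW, mem_filter]
    exact ⟨mem_univ _, by simp [hι], h1, h2⟩
  have hcardle : ((range T).filter fun i => A ≤ f i ∧ f i ≤ B).card ≤ W.card := by
    rw [← Finset.card_image_of_injOn hinj]
    exact Finset.card_le_card himg
  have hcast : (((range T).filter fun i => A ≤ f i ∧ f i ≤ B).card : ℝ) ≤ (W.card : ℝ) := by exact_mod_cast hcardle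
  have hre : (B - A) * L / (2 * π * v) = (B - A) / δ := by
    rw [hδ]; field_simp
  rw [hre]
  exact hcount.trans hcast

omit hjκ in
/-- **Level-set floor from crossing columns**: for a set `C` of columns each containing a point with `e_K < A` and a point with `B < e_K` (`A ≤ B`),
`#C·((B − A)·L/(2πv) − 1) ≤ #{k⃗ : A ≤ e_K(p_k⃗) ≤ B}`. [folklore] -/
theorem kllfv_levelSet_card_ge {A B : ℝ} (hAB : A ≤ B) (C : Finset (ZMod L))
    (hC : ∀ a ∈ C, (∃ k : TorusSite 2 L, k 0 = a ∧ nambuXiCT L μ K k < A) ∧ ∃ k : TorusSite 2 L, k 0 = a ∧ B < nambuXiCT L μ K k) :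
    (C.card : ℝ) * ((B - A) * L / (2 * π * v) - 1) ≤
      (((univ : Finset (TorusSite 2 L)).filter fun k => A ≤ nambuXiCT L μ K k ∧ nambuXiCT L μ K k ≤ B).card : ℝ) := by
  classical
  set W := (univ : Finset (TorusSite 2 L)).filter fun k => A ≤ nambuXiCT L μ K k ∧ nambuXiCT L μ K k ≤ B with hW
  set WC := W.filter fun k => k 0 ∈ C with hWC
  -- fibrewise decomposition of `WC` over the columns in `C`
  have hfib : WC.card = ∑ a ∈ C, (WC.filter fun k => k 0 = a).card :=
    Finset.card_eq_sum_card_fiberwise fun k hk => by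
      have := (mem_filter.1 (Finset.mem_coe.1 hk)).2
      exact Finset.mem_coe.2 this
  have hcol : ∀ a ∈ C, (WC.filter fun k => k 0 = a) =
      (univ : Finset (TorusSite 2 L)).filter fun k => k 0 = a ∧ (A ≤ nambuXiCT L μ K k ∧ nambuXiCT L μ K k ≤ B) := by
    intro a ha
    ext k
    simp only [hWC, hW, mem_filter, mem_univ, true_and]
    constructor
    · rintro ⟨⟨h1, -⟩, h3⟩; exact ⟨h3, h1⟩
    · rintro ⟨h3, h1⟩; exact ⟨⟨h1, h3 ▸ ha⟩, h3⟩
  have hsum : (C.card : ℝ) * ((B - A) * L / (2 * π * v) - 1) ≤ (WC.card : ℝ) := by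
    rw [hfib]
    push_cast
    rw [show (C.card : ℝ) * ((B - A) * L / (2 * π * v) - 1) = ∑ a ∈ C, ((B - A) * L / (2 * π * v) - 1) by
      rw [Finset.sum_const, nsmul_eq_mul]]
    refine Finset.sum_le_sum fun a ha => ?_
    rw [hcol a ha]
    obtain ⟨⟨klo, hklo, hlo⟩, khi, hkhi, hhi⟩ := hC a ha
    exact kllfv_column_window_card_ge μ K hjet hjv hAB a hklo hkhi hlo hhi
  have hle : WC.card ≤ W.card := Finset.card_le_card (Finset.filter_subset _ _)
  exact hsum.trans (Nat.cast_le.2 hle)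

end Grid

end Summit.HubbardSuperconductivity.HubbardSuperconductivity.Theorems.KLRegimeSplit

end

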